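import Summits.SmoothPoincare4.SmoothPoincare4.Theorems.ConvexBisectionAcyclicBisectionExistsBeltSlideToTube
import Summits.SmoothPoincare4.SmoothPoincare4.Theorems.ConvexBisectionAcyclicBisectionExistsBeltTubeShrink
import HarnessLib

/-!
# From the end of the belt-circle slide to ANY second tube around the attaching circle, in `∂P`
# (stages (3a)+(3c) of node T3c-1 without the smallness hypothesis)
(node T3c-1 `node_belt_isotopic_pushoff` of the sub-goal T3 of stub `stub_steinRealisation` (NF6), line
`modp-braid-orbits`, crux `ConvexBisection.AcyclicBisectionExists`, item stmt-SmoothPoincare4-10508;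
wave 3, worker Z5, lead c5)

`helper_belt_slideToTube` (`…BeltSlideToTube.lean`) compares the attaching tube of handle `i` with a second
tube `Φ₂` of `∂M` whose target is small.  Here the smallness hypothesis is removed by shrinking `Φ₂` radially
first (`…BeltTubeShrink.lean`: the core, the rotation field and the sign condition of
`CircleTube.exists_diffeotopy_reflect` are preserved): **for every second tube `Φ₂` around the attaching
circle of `h i` satisfying the hypotheses of the uniqueness theorem there are `κ ∈ (0, 1]` and `r₀ > 0` such
that for `0 < r < r₀` the end framed knot of the belt-circle slide is isotopic through knots of `∂P` off the
cores, carrying its framing, to `θ ↦ jA (Φ₂ (uDir b θ, κ · reflFibre s (r θ)))` framed by `d(jA)` of the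
velocity of `ε ↦ Φ₂ (uDir b θ, κ · (reflFibre s (r θ) + ε reflFibre s (θ²)))`** (`exists_slideEnd_to_anyTube`;
registered helper `helper_belt_slideToAnyTube`; the end data are `tubeEndPoint`/`tubeEndFraming` of the shrunk
tube `shrinkTube Φ₂ κ`, whose values are given by `shrinkTube_apply`).

Everything is proved; no named facts.

## References
* A. A. Kosinski, *Differential Manifolds*, Academic Press (1993), III (3.1), (3.5), VI §6. [Kosinski1993]
-/

noncomputable section

-- the prescribed namespace `Summit.<P>.<Sub>.…` duplicates `SmoothPoincare4` (P = Sub)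
set_option linter.dupNamespace false

open scoped Manifold ContDiff Topology
open Set Function Metric Filter Bundle

namespace Summit.SmoothPoincare4.SmoothPoincare4.Theorems.AcyclicBisectionExists.ModpBraidOrbits

open Literature.Topology.FourManifolds Literature.Topology.FourManifolds.HandleAttachingMap
  Literature.Geometry.Symplectic

variable {ι : Type*} [Finite ι] {M : Type} [TopologicalSpace M] [T2Space M] [CompactSpace M]
  [ChartedSpace (EuclideanHalfSpace 4) M] [IsManifold (𝓡∂ 4) ∞ M] {h : ι → HandleAttachingMap 3 2 M}
  {P : Type*} [TopologicalSpace P] [T2Space P] [ChartedSpace (EuclideanHalfSpace 4) P] [IsManifold (𝓡∂ 4) ∞ P]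

omit [T2Space M] [CompactSpace M] in
/-- The quarter tube of the boundary tube is an open neighbourhood of the core. [folklore] -/
theorem isOpen_boundaryTube_quarter (f : HandleAttachingMap 3 2 M) :
    IsOpen (f.boundaryTube.toHomeo '' ((univ : Set (sphere (0 : EuclideanSpace ℝ (Fin 2)) 1)) ×ˢ
      ball (0 : EuclideanSpace ℝ (Fin 2)) (1 / 4))) := by
  refine f.boundaryTube.toHomeo.isOpen_image_of_subset_source (isOpen_univ.prod isOpen_ball) ?_
  rintro ⟨θ, w⟩ ⟨-, hw⟩
  rw [mem_ball_zero_iff] at hw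
  exact f.boundaryTube.mem_source_iff.2 (by linarith)

/-- **Stages (3a)+(3c) in `∂P` for ANY second tube** (shrink first). [cite: Kosinski1993, III (3.5) and VI §6] -/
theorem exists_slideEnd_to_anyTube (D : MultiAttachmentData h (𝓡∂ 4) P) (i : ι) (b : Bool)
    {Φ₂ : CircleTube ↥((𝓡∂ 4).boundary M)} (hcore : ∀ θ, (h i).boundaryTube.core θ = Φ₂.core θ)
    {s : ℝ} (hs : s ^ 2 = 1) (hsgn : ∀ x, 0 < s * CircleTube.frameSign (h i).boundaryTube Φ₂ x)
    {β : sphere (0 : EuclideanSpace ℝ (Fin 2)) 1 → ℝ} (hβ : ContMDiff (𝓡 1) 𝓘(ℝ, ℝ) ∞ β)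
    (hang : ∀ x, CircleTube.frameVec (h i).boundaryTube Φ₂ x = rotPlane (β x) planeE0) :
    ∃ (κ : ℝ) (hκ : 0 < κ) (hκ1 : κ ≤ 1) (r₀ : ℝ), 0 < r₀ ∧ r₀ ≤ 1 / 4 ∧ ∀ r : ℝ, 0 < r → r < r₀ →
      ∃ (hmem : ∀ θ : sphere (0 : EuclideanSpace ℝ (Fin 2)) 1, (h i).toFun (tubeLongitudePt b r θ) ∈ coresComplement h)
        (hmem' : ∀ θ : sphere (0 : EuclideanSpace ℝ (Fin 2)) 1,
          tubeEndPoint (shrinkTube Φ₂ hκ hκ1) b s r θ ∈ coresComplement h)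
        (Ψ : KnotIsotopyInBoundary (fun θ => D.jA ⟨(h i).toFun (tubeLongitudePt b r θ), hmem θ⟩)
          (fun θ => D.jA ⟨tubeEndPoint (shrinkTube Φ₂ hκ hκ1) b s r θ, hmem' θ⟩))
        (νt : ℝ → sphere (0 : EuclideanSpace ℝ (Fin 2)) 1 → EuclideanSpace ℝ (Fin 4)),
        (∀ t θ, ∃ a : ↥(coresComplement h), (a : M) ∈ range (h i).toFun ∧ Ψ.toFun t θ = D.jA a) ∧
        IsFramingAlong Ψ
          (fun θ => mfderiv (𝓡∂ 4) (𝓡∂ 4) (fun a : ↥(coresComplement h) => D.jA a)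
            ⟨(h i).toFun (tubeLongitudePt b r θ), hmem θ⟩
            (mfderiv (𝓡∂ 4) (𝓡∂ 4) (h i).toFun (tubeLongitudePt b r θ)
              ((closedBallCoeDeriv ((tubeLongitudePt b r θ : ↥(handleTube 3 2)) :
                closedBall (0 : EuclideanSpace ℝ (Fin 4)) 1)).symm (slideEndVec b r θ))))
          νt ∧
        ∀ θ, νt 1 θ = mfderiv (𝓡∂ 4) (𝓡∂ 4) D.jA ⟨tubeEndPoint (shrinkTube Φ₂ hκ hκ1) b s r θ, hmem' θ⟩
          (tubeEndFraming (shrinkTube Φ₂ hκ hκ1) b s r θ) := by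
  -- shrink `Φ₂` into the quarter tube of the attaching tube
  have hcO : ∀ θ, Φ₂.core θ ∈ (h i).boundaryTube.toHomeo ''
      ((univ : Set (sphere (0 : EuclideanSpace ℝ (Fin 2)) 1)) ×ˢ ball (0 : EuclideanSpace ℝ (Fin 2)) (1 / 4)) := by
    intro θ
    rw [← hcore θ, CircleTube.core_apply]
    exact ⟨(θ, 0), ⟨mem_univ _, by simp⟩, rfl⟩
  obtain ⟨κ, hκ, hκ1, hsmall⟩ := exists_shrinkTube_target_subset (Φ := Φ₂) (isOpen_boundaryTube_quarter (h i)) hcO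
  have hcore' : ∀ θ, (h i).boundaryTube.core θ = (shrinkTube Φ₂ hκ hκ1).core θ := core_eq_shrinkTube hκ hκ1 hcore
  have hsgn' : ∀ x, 0 < s * CircleTube.frameSign (h i).boundaryTube (shrinkTube Φ₂ hκ hκ1) x :=
    frameSign_shrinkTube_pos hκ hκ1 hcore hsgn
  have hang' : ∀ x, CircleTube.frameVec (h i).boundaryTube (shrinkTube Φ₂ hκ hκ1) x = rotPlane (β x) planeE0 :=
    fun x => by rw [frameVec_shrinkTube hκ hκ1 hcore x]; exact hang x
  obtain ⟨r₀, hr₀, hr₀4, H⟩ := exists_slideEnd_to_tube D i b hcore' hs hsgn' hβ hang' hsmall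
  exact ⟨κ, hκ, hκ1, r₀, hr₀, hr₀4, H⟩

/-! ### Registered helper -/

/-- **Registered helper `helper_belt_slideToAnyTube` (node T3c-1 of NF6 `stub_steinRealisation`, stages
(3a)+(3c) in `∂P` for ANY second tube, wave 3, lead c5).**  As `helper_belt_slideToTube`, for every second
tube `Φ₂` of `∂M` around the attaching circle of `h i` with the hypotheses of
`CircleTube.exists_diffeotopy_reflect` (no smallness): after shrinking `Φ₂` radially by some `κ ∈ (0, 1]`
(`shrinkTube Φ₂ κ (θ, w) = Φ₂ (θ, κ w)`) the end framed knot of the belt-circle slide is isotopic through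
knots of `∂P` off the cores, carrying its framing, to the explicit framed knot in the coordinates of the
shrunk tube (`tubeEndPoint`, `tubeEndFraming`). [cite: Kosinski1993, III (3.5) and VI §6] -/
theorem helper_belt_slideToAnyTube :
    ∀ {ι : Type} [Finite ι] {M : Type} [TopologicalSpace M] [T2Space M] [CompactSpace M]
      [ChartedSpace (EuclideanHalfSpace 4) M] [IsManifold (𝓡∂ 4) ∞ M]
      {h : ι → Literature.Topology.FourManifolds.HandleAttachingMap 3 2 M}
      {P : Type} [TopologicalSpace P] [T2Space P] [ChartedSpace (EuclideanHalfSpace 4) P] [IsManifold (𝓡∂ 4) ∞ P]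
      (D : Literature.Topology.FourManifolds.HandleAttachingMap.MultiAttachmentData h (𝓡∂ 4) P) (i : ι) (b : Bool)
      (Φ₂ : Literature.Topology.FourManifolds.CircleTube ↥((𝓡∂ 4).boundary M))
      (_ : ∀ θ, (h i).boundaryTube.core θ = Φ₂.core θ) (s : ℝ) (_ : s ^ 2 = 1)
      (_ : ∀ x, 0 < s * Literature.Topology.FourManifolds.CircleTube.frameSign (h i).boundaryTube Φ₂ x)
      (β : Metric.sphere (0 : EuclideanSpace ℝ (Fin 2)) 1 → ℝ) (_ : ContMDiff (𝓡 1) 𝓘(ℝ, ℝ) ∞ β)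
      (_ : ∀ x, Literature.Topology.FourManifolds.CircleTube.frameVec (h i).boundaryTube Φ₂ x =
        Literature.Topology.FourManifolds.rotPlane (β x) Literature.Topology.FourManifolds.planeE0),
      ∃ (κ : ℝ) (hκ : 0 < κ) (hκ1 : κ ≤ 1) (r₀ : ℝ), 0 < r₀ ∧ r₀ ≤ 1 / 4 ∧ ∀ r : ℝ, 0 < r → r < r₀ →
        ∃ (hmem : ∀ θ : Metric.sphere (0 : EuclideanSpace ℝ (Fin 2)) 1,
            (h i).toFun (Summit.SmoothPoincare4.SmoothPoincare4.Theorems.AcyclicBisectionExists.ModpBraidOrbits.tubeLongitudePt b r θ) ∈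
              Literature.Topology.FourManifolds.HandleAttachingMap.coresComplement h)
          (hmem' : ∀ θ : Metric.sphere (0 : EuclideanSpace ℝ (Fin 2)) 1,
            Summit.SmoothPoincare4.SmoothPoincare4.Theorems.AcyclicBisectionExists.ModpBraidOrbits.tubeEndPoint
              (Summit.SmoothPoincare4.SmoothPoincare4.Theorems.AcyclicBisectionExists.ModpBraidOrbits.shrinkTube Φ₂ hκ hκ1) b s r θ ∈
              Literature.Topology.FourManifolds.HandleAttachingMap.coresComplement h)
          (Ψ : Literature.Geometry.Symplectic.KnotIsotopyInBoundary
            (fun θ => D.jA ⟨(h i).toFun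
              (Summit.SmoothPoincare4.SmoothPoincare4.Theorems.AcyclicBisectionExists.ModpBraidOrbits.tubeLongitudePt b r θ), hmem θ⟩)
            (fun θ => D.jA ⟨Summit.SmoothPoincare4.SmoothPoincare4.Theorems.AcyclicBisectionExists.ModpBraidOrbits.tubeEndPoint
              (Summit.SmoothPoincare4.SmoothPoincare4.Theorems.AcyclicBisectionExists.ModpBraidOrbits.shrinkTube Φ₂ hκ hκ1) b s r θ,
                hmem' θ⟩))
          (νt : ℝ → Metric.sphere (0 : EuclideanSpace ℝ (Fin 2)) 1 → EuclideanSpace ℝ (Fin 4)),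
          (∀ t θ, ∃ a : ↥(Literature.Topology.FourManifolds.HandleAttachingMap.coresComplement h),
            (a : M) ∈ Set.range (h i).toFun ∧ Ψ.toFun t θ = D.jA a) ∧
          Literature.Geometry.Symplectic.IsFramingAlong Ψ
            (fun θ => mfderiv (𝓡∂ 4) (𝓡∂ 4)
              (fun a : ↥(Literature.Topology.FourManifolds.HandleAttachingMap.coresComplement h) => D.jA a)
              ⟨(h i).toFun (Summit.SmoothPoincare4.SmoothPoincare4.Theorems.AcyclicBisectionExists.ModpBraidOrbits.tubeLongitudePt b r θ),
                hmem θ⟩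
              (mfderiv (𝓡∂ 4) (𝓡∂ 4) (h i).toFun
                (Summit.SmoothPoincare4.SmoothPoincare4.Theorems.AcyclicBisectionExists.ModpBraidOrbits.tubeLongitudePt b r θ)
                ((Literature.Topology.FourManifolds.closedBallCoeDeriv
                  ((Summit.SmoothPoincare4.SmoothPoincare4.Theorems.AcyclicBisectionExists.ModpBraidOrbits.tubeLongitudePt b r θ :
                    ↥(Literature.Topology.FourManifolds.handleTube 3 2)) : Metric.closedBall (0 : EuclideanSpace ℝ (Fin 4)) 1)).symm
                  (Summit.SmoothPoincare4.SmoothPoincare4.Theorems.AcyclicBisectionExists.ModpBraidOrbits.slideEndVec b r θ))))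
            νt ∧
          ∀ θ, νt 1 θ = mfderiv (𝓡∂ 4) (𝓡∂ 4) D.jA
            ⟨Summit.SmoothPoincare4.SmoothPoincare4.Theorems.AcyclicBisectionExists.ModpBraidOrbits.tubeEndPoint
              (Summit.SmoothPoincare4.SmoothPoincare4.Theorems.AcyclicBisectionExists.ModpBraidOrbits.shrinkTube Φ₂ hκ hκ1) b s r θ, hmem' θ⟩
            (Summit.SmoothPoincare4.SmoothPoincare4.Theorems.AcyclicBisectionExists.ModpBraidOrbits.tubeEndFraming
              (Summit.SmoothPoincare4.SmoothPoincare4.Theorems.AcyclicBisectionExists.ModpBraidOrbits.shrinkTube Φ₂ hκ hκ1) b s r θ) := by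
  intro ι _ M _ _ _ _ _ h P _ _ _ _ D i b Φ₂ hcore s hs hsgn β hβ hang
  exact exists_slideEnd_to_anyTube D i b hcore hs hsgn hβ hang

end Summit.SmoothPoincare4.SmoothPoincare4.Theorems.AcyclicBisectionExists.ModpBraidOrbits

end
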